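import Literature.IUT.HodgeArakelov.BadPlaceSettingAtModelTate
import Literature.IUT.HodgeArakelov.MonoThetaProjectiveNaturalTheta
import Literature.IUT.HodgeArakelov.MonoThetaProjectiveNaturalSystemProofs
import Literature.IUT.HodgeArakelov.MonoThetaProjectiveThetaEnvFacts
import Literature.IUT.HodgeArakelov.MonoThetaProjectiveBridgeEtThFacts
import Literature.AnabelianGeometry.EtaleTheta.SettingModelTateProp15TruthTable
import HarnessLib

/-!
# [IUTchII] Prop. 1.5 — the NATURAL projective system of mono-theta environments of the Tate curve AT THE [EtTh]
# TATE MODEL `ThetaSetting.modelTate p`: every `Prop` binder of the [EtTh] §1 package discharged (proof-only; K-L6)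

S. Mochizuki, *Inter-universal Teichmüller theory II*, kurims manuscript (Dec. 2020), Prop. 1.5 (i)–(iii) pp. 29–30
[claim: Mochizuki2012, status: disputed] (IUTchII §1 Prop 1.5, kurims p.29); S. Mochizuki, *The étale theta function
…*, Publ. RIMS **45** (2009) [EtTh], Def. 2.7 p. 41, Def. 2.13 p. 46, Cor. 2.18 (i), (iv) pp. 60–62, Cor. 2.19 (ii),
(iii) p. 64 (PRIMS PDF pages) [cite: MochizukiEtTh2009, Cor 2.19(ii) p.64].  Cell `abc-iut`, seat abc-iut-w5-d233
(gen 5; lineage: `MonoThetaProjectiveNaturalSystem`, p414240), sequel of this seat's `BadPlaceSettingAtModelTate`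
(p453435; D-0079 K-L6 slice «`Sec2Hyps` bundle — genuine-instance constructions at the [EtTh] models»).  PROOF-ONLY:
no definition, no instance, no new named fact; every input consumed BY NAME.

STATE OF RECORD.  The natural system `EtaleLevels.naturalSystem C hC hS hl hp2 hpl hζ mods f hf hmods h15 L hZ`
(abc-iut-w4-d030 / w4-d038 / w5-d233; `= modelSystem`, `naturalSystem_eq_modelSystem`) of [IUTchII] Prop. 1.5 over
the Tate curve of an [EtTh] §1 setting `D` carries the binders `E, C, hC, hS, hl, hp2, hpl, hζ`, a compatible
cyclotome family `mods/hmods` (or tower `τ`), a ROOT COCYCLE `f ∈ C.rootCocycles hC`, `h15 : Prop15iii`,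
`L : CuspLabels`, `hZ` ("`(l·Δ_Θ)(M) ≅ Ẑ`"); its Prop. 1.5 theorems (abc-iut-L2-t10 `…_of_origin`) add `Prop15ii`,
temp-slimness, `IsOpenMap aug`, `IsEtThOrigin`, `hYcl`, [EtTh] Cor. 2.18 (i) at the chain levels, Cor. 2.19 (iii).
abc-iut-f-150's `…AtModelChi` capstones discharge four of them at the χ-model and keep the rest as binders.

THIS FILE, at the Tate model `modelTate p = modelχq p 1 2` (`p` prime, `l` an odd prime with `4l ∣ p − 1`), over the
data of record of `BadPlaceSettingAtModelTate` (the `inr`-section étale-theta datum carrying `η̈♯`, `X̲̲` with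
`Π^tp_X̲̲ = Huuχq`, the empty labelling) and a compatible cyclotome TOWER `τ` (DATA; inhabited: abc-iut-L2-t8
`modelχq_nonempty_cyclotomeTower`):
* `rootLift_mem_rootCocycles` — for EVERY setting, abc-iut-L6-t1's one-root lift `rootLift C` IS a root cocycle
  (the `hf` binder of the whole `EtaleLevels` chain needs no input);
* `naturalSystem_level_rows_modelTate` — the level rows of the natural system at the Tate model with NO `Prop`
  binder: `Π_X = Π^tp_{X̲̲}` (`naturalSystem_PiX`), trivial `X`-transitions (II:Prop1.5(ii) sub-row L02
  `naturalSystem_transX`), the exterior cyclotome `Π_μ(M^Θ_M) = μ_M` and the reductions of `inMu` (II:Prop1.5(iii)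
  sub-row L01 `mem_extCyc_iff` / `inMu_mem_extCyc` / `red_inMu`), and `IsMonoThetaCompatible` of the natural system
  (`naturalSystem_isMonoThetaCompatible`, temp-slimness supplied by abc-iut-L2-t5's `isSlimGroup_piTemp_modelχq`);
* `nonempty_thetaEnvData_modelTate`, `transitionsAreIsos_modelSystem_modelTate`,
  `prop15_i_i'_ii_iii_modelSystem_modelTate` — the `θ_env` data (II:Prop1.5(iii)), Prop. 1.5 (ii)
  (`transitionsAreIsos`) and the four-clause summary (i) (printed form), (i)′, (ii)+(iii) at the Tate model with
  `h15`, `h15ii` (abc-iut-L2-t6 / w5-d140 / L6-d5), `L`, temp-slimness, `IsOpenMap aug`, `IsEtThOrigin`, `hYcl`, `hζ`,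
  `hf` ALL discharged — residual named inputs = [EtTh] Cor. 2.18 (i) at the chain levels of `τ` (F-0620, instance
  form) and `ThetaEnvTower.Cor219_iii` of the model tower ONLY;
* census `ThetaSetting.exists_isEtThOrigin_sec2Hyps_naturalSystem_of_dvd_pred`.

HONEST LABEL: `modelTate` is a SEMI-SYNTHETIC model of the typed [EtTh] §1 interface (not the tempered `π₁` of a
curve): joint-satisfiability / non-vacuity evidence for the binders of the [IUTchII] Prop. 1.5 chain (OUR kernel
check that `Sec2Hyps` and its companions are realised TOGETHER at one genuine, non-toy carrier); the [IUTchII] claim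
key `Mochizuki2012` is DISPUTED (D-0012) and nothing of it is asserted; nothing of [EtTh] is asserted beyond the tree's
proofs; no side is taken on [IUTchIII] Cor. 3.12; typed ≠ proved; nothing here says abc is proved or refuted.
-/

noncomputable section

namespace Literature.IUT.HodgeArakelov

open Literature.AnabelianGeometry.EtaleTheta Literature.AnabelianGeometry.SemiGraphs
open Literature.AnabelianGeometry.EtaleTheta.SettingModel
open scoped Literature.AnabelianGeometry.EtaleTheta

namespace ModelTateCarriers

/-! ## §1. The root cocycle needs no input -/

/-- **The one-root lift IS a root cocycle** (every [EtTh] §1 setting): abc-iut-L6-t1's `rootLift C` — an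
`l·Δ_Θ`-valued continuous cocycle on `Π^tp_{Ÿ̲̲}` representing `η̈^Θ|_{Π^tp_{Ÿ̲̲}}` — lies in abc-iut-L2-t8's
`C.rootCocycles hC` (its class is the `σ = 1` member of the orbit `η̲̈^{Θ,l·ℤ×μ₂}`), so the binder
`hf : f ∈ C.rootCocycles hC` of the `EtaleLevels` chain is dischargeable BY NAME everywhere.
[cite: MochizukiEtTh2009, Def 2.7 p.41] -/
theorem rootLift_mem_rootCocycles {p : ℕ} [Fact p.Prime]
    {D : Literature.AnabelianGeometry.EtaleTheta.ThetaSetting p} {E : D.EtaleThetaData} {l : ℕ}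
    (C : E.DoubleUnderline l) (hC : D.Compat) :
    EtaleThetaDataOfSetting.rootLift C ∈ C.rootCocycles hC := by
  haveI := hC.GtpYdd_normal
  refine ⟨EtaleThetaDataOfSetting.rootLift_val C, 1, one_mem _, ?_⟩
  rw [Literature.AnabelianGeometry.EtaleTheta.ThetaSetting.EtaleThetaData.DoubleUnderline.contH1_conj_one]
  exact EtaleThetaDataOfSetting.rootLift_mk C

/-! ## §2. The natural system at the Tate model: level rows with NO `Prop` binder -/

variable (p : ℕ) [Fact p.Prime] (l : ℕ+) (hl : Odd (l : ℕ)) (hlp : (l : ℕ).Prime) (hdvd : 4 * (l : ℕ) ∣ p - 1)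
  {Es : Set ℕ+} (τ : (ThetaSetting.modelχq p 1 2 even_two).CyclotomeTower l Es)

/-- **The level rows of the natural system of the Tate curve AT THE TATE MODEL, NO `Prop` binder** (only `p`, an odd
prime `l` with `4l ∣ p − 1`, and a compatible cyclotome tower `τ` — DATA): with `Sys := EtaleLevels.naturalSystem …`
over the data of record (root cocycle := `rootLift`, `h15`/`hζ`/`hZ` theorems of the tree),
(a) `Π_X(Sys) = Π^tp_{X̲̲} = Huuχq`; (b) the `X`-transition maps are the identity (II:Prop1.5(ii), sub-row L02);
(c) `Π_μ(M^Θ_M) = {z | z.right = 1} ∋ inMu a`, with `inMu` compatible with the reductions (II:Prop1.5(iii), sub-row L01;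
the level-`M` rigidity bookkeeping of sub-row L04, `extEquiv_intModEquiv_symm_apply`, instantiates verbatim and is not
restated); (d) `Sys` is `IsMonoThetaCompatible` for the reduction data (temp-slimness supplied).
[claim: Mochizuki2012, status: disputed] (IUTchII §1 Prop 1.5 (iii), kurims pp.29-30) -/
theorem naturalSystem_level_rows_modelTate :
    let hC := compat_modelχq p 1 2 even_two
    let hS := ThetaSetting.modelχq_sec2Hyps p 1 2 even_two
    let K₀ := (kummerCoreχq p 1 2 even_two).toKummerDataOfSection SemidirectProduct.inr (continuous_inrχq p 1 2)
        (fun _ => rfl) (map_inr_GK_le_GtpY_modelχq' p 1 2 even_two) (map_inr_GKdd_le_GtpYdd_modelχq' p 1 2 even_two)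
    let C := (K₀.etaleThetaDataOfClass (etaDdχq p 1 2 even_two)).doubleUnderlineχqOfEtaRes p 1 2 l hl
        (eta_res_etaDdχq p 1 2 even_two l hl)
    let h15 : Literature.AnabelianGeometry.EtaleTheta.ThetaSetting.Prop15iii _ hC :=
      prop15iii_etaleThetaDataOfClass_etaDdχq p hC SemidirectProduct.inr
        (continuous_inrχq p 1 2) (fun _ => rfl) (map_inr_GK_le_GtpY_modelχq' p 1 2 even_two)
        (map_inr_GKdd_le_GtpYdd_modelχq' p 1 2 even_two)
    let L : C.CuspLabels := ⟨fun _ => ∅, fun _ => ∅, fun _ => rfl⟩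
    let hO := ThetaSetting.modelχq_isEtThOrigin p 1 2 even_two
    let hYcl := hYcl_modelχq p 1 2 even_two
    let hp2 := ne_two_of_four_mul_dvd_pred p l.pos hdvd
    let hpl := ne_of_four_mul_dvd_pred p l.pos hdvd
    let hζ := exists_isPrimitiveRoot_K_modelχq p 1 2 even_two l.pos hdvd
    let hZ : ∀ M : ℕ+, Nonempty (ModelCyclotomes.lDeltaQuot (C.rigidData (τ.modAll M) hC hS h15 L) ≃*
        Literature.IUT.HodgeTheaters.ZHat) := fun M =>
      ModelCyclotomes.nonempty_lDeltaQuot_rigidData_mulEquiv_zHat C (τ.modAll M) hC hS h15 L hO hYcl hlp.ne_zero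
    let Sys := EtaleLevels.naturalSystem C hC hS hlp hp2 hpl hζ τ.modAll (EtaleThetaDataOfSetting.rootLift C)
      (rootLift_mem_rootCocycles C hC) τ.red_modAll h15 L hZ
    Sys.PiX = TopGroup.of C.Huu ∧
      (∀ {M M' : ℕ+} (h : (M : ℕ) ∣ (M' : ℕ)) (x : C.Huu), Sys.transX h x = x) ∧
      (∀ (M : ℕ+) (z : (EtaleLevels.levelData C hC hS τ.modAll M).env), z ∈ (Sys.recon M).extCyc ↔ z.right = 1) ∧
      (∀ (M : ℕ+) (a : MuN p M),
        CycEnvelope.inMu (EtaleLevels.levelData C hC hS τ.modAll M).augY (EtaleLevels.levelData C hC hS τ.modAll M).chi a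
          ∈ (Sys.recon M).extCyc) ∧
      (∀ {M M' : ℕ+} (h : (M : ℕ) ∣ (M' : ℕ)) (a : MuN p M'),
        EtaleLevels.red C hC hS τ.modAll h
            (CycEnvelope.inMu (EtaleLevels.levelData C hC hS τ.modAll M').augY
              (EtaleLevels.levelData C hC hS τ.modAll M').chi a) =
          CycEnvelope.inMu (EtaleLevels.levelData C hC hS τ.modAll M).augY
            (EtaleLevels.levelData C hC hS τ.modAll M).chi (MuN.red p M M' h a)) ∧
      MonoThetaProjSystem.IsMonoThetaCompatible
        (EtaleLevels.reductions C hC hS hlp hp2 hpl hζ τ.modAll (EtaleThetaDataOfSetting.rootLift C)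
          (rootLift_mem_rootCocycles C hC) τ.red_modAll (isSlimGroup_piTemp_modelχq p 1 2 even_two)) Sys := by
  intro hC hS K₀ C h15 L hO hYcl hp2 hpl hζ hZ Sys
  refine ⟨EtaleLevels.naturalSystem_PiX C hC hS hlp hp2 hpl hζ _ _ _ _ h15 L hZ,
    fun h x => EtaleLevels.naturalSystem_transX C hC hS hlp hp2 hpl hζ _ _ _ _ h15 L hZ h x,
    fun M z => EtaleLevels.mem_extCyc_iff C hC hS hlp hp2 hpl hζ _ _ _ _ h15 L hZ M z,
    fun M a => EtaleLevels.inMu_mem_extCyc C hC hS hlp hp2 hpl hζ _ _ _ _ h15 L hZ M a,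
    fun h a => EtaleLevels.red_inMu C hC hS τ.modAll h a,
    EtaleLevels.naturalSystem_isMonoThetaCompatible C hC hS hlp hp2 hpl hζ _ _ _ _ h15 L hZ _⟩

/-! ## §3. The `θ_env` data, Prop. 1.5 (ii) and the four-clause summary at the Tate model — residual inputs =
[EtTh] Cor. 2.18 (i) at the chain levels and `ThetaEnvTower.Cor219_iii` ONLY -/

/-- **II:Prop1.5(iii) — the `θ_env` data of the natural system EXIST at the Tate model**, modulo [EtTh] Cor. 2.18 (i)
at the chain level `1` of `τ` ONLY (`h15`, `L`, `hζ`, `hf`, `IsEtThOrigin`, `hYcl` all theorems of the tree):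
abc-iut-L2-t10's `nonempty_thetaEnvData_of_origin` at the data of record (`modelSystem = naturalSystem`,
`naturalSystem_eq_modelSystem`). [claim: Mochizuki2012, status: disputed] (IUTchII §1 Prop 1.5 (iii), kurims pp.29-30) -/
theorem nonempty_thetaEnvData_modelTate :
    let hC := compat_modelχq p 1 2 even_two
    let hS := ThetaSetting.modelχq_sec2Hyps p 1 2 even_two
    let K₀ := (kummerCoreχq p 1 2 even_two).toKummerDataOfSection SemidirectProduct.inr (continuous_inrχq p 1 2)
        (fun _ => rfl) (map_inr_GK_le_GtpY_modelχq' p 1 2 even_two) (map_inr_GKdd_le_GtpYdd_modelχq' p 1 2 even_two)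
    let C := (K₀.etaleThetaDataOfClass (etaDdχq p 1 2 even_two)).doubleUnderlineχqOfEtaRes p 1 2 l hl
        (eta_res_etaDdχq p 1 2 even_two l hl)
    let h15 : Literature.AnabelianGeometry.EtaleTheta.ThetaSetting.Prop15iii _ hC :=
      prop15iii_etaleThetaDataOfClass_etaDdχq p hC SemidirectProduct.inr
        (continuous_inrχq p 1 2) (fun _ => rfl) (map_inr_GK_le_GtpY_modelχq' p 1 2 even_two)
        (map_inr_GKdd_le_GtpYdd_modelχq' p 1 2 even_two)
    let L : C.CuspLabels := ⟨fun _ => ∅, fun _ => ∅, fun _ => rfl⟩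
    let hO := ThetaSetting.modelχq_isEtThOrigin p 1 2 even_two
    let hYcl := hYcl_modelχq p 1 2 even_two
    let hp2 := ne_two_of_four_mul_dvd_pred p l.pos hdvd
    let hpl := ne_of_four_mul_dvd_pred p l.pos hdvd
    let hζ := exists_isPrimitiveRoot_K_modelχq p 1 2 even_two l.pos hdvd
    let hZ : ∀ M : ℕ+, Nonempty (ModelCyclotomes.lDeltaQuot (C.rigidData (τ.modAll M) hC hS h15 L) ≃*
        Literature.IUT.HodgeTheaters.ZHat) := fun M =>
      ModelCyclotomes.nonempty_lDeltaQuot_rigidData_mulEquiv_zHat C (τ.modAll M) hC hS h15 L hO hYcl hlp.ne_zero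
    let Sys := EtaleLevels.modelSystem C hC hS hlp hp2 hpl hζ τ.modAll (EtaleThetaDataOfSetting.rootLift C)
      (rootLift_mem_rootCocycles C hC) τ.red_modAll h15 L hZ
    ∀ _h218i₁ : (C.rigidData (τ.mod ⟨1, τ.one_mem⟩) hC hS h15 L).Cor218_i, Nonempty (ThetaEnvData Sys) := by
  intro hC hS K₀ C h15 L hO hYcl hp2 hpl hζ hZ Sys h218i₁
  exact EtaleLevels.nonempty_thetaEnvData_of_origin C hC hS hlp hp2 hpl hζ τ _ _ h15 L h218i₁ hO hYcl

/-- **II:Prop1.5(ii) — the transition morphisms of the natural system are isomorphisms at the Tate model**, modulo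
[EtTh] Cor. 2.18 (i) at the chain levels of `τ` and `ThetaEnvTower.Cor219_iii` of the model tower ONLY (Prop. 1.5 (ii),
(iii) of [EtTh] §1, `L`, `hZ`, `IsEtThOrigin`, `hYcl` discharged — `h15ii` by abc-iut-w5-d140 / L6-d5's kit theorem
`prop15_i_ii_ofKit_inrSection_modelχq`): abc-iut-L2-t10's `transitionsAreIsos_modelSystem_of_origin`.
[claim: Mochizuki2012, status: disputed] (IUTchII §1 Prop 1.5 (ii), kurims p.29) -/
theorem transitionsAreIsos_modelSystem_modelTate :
    let hC := compat_modelχq p 1 2 even_two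
    let hS := ThetaSetting.modelχq_sec2Hyps p 1 2 even_two
    let K₀ := (kummerCoreχq p 1 2 even_two).toKummerDataOfSection SemidirectProduct.inr (continuous_inrχq p 1 2)
        (fun _ => rfl) (map_inr_GK_le_GtpY_modelχq' p 1 2 even_two) (map_inr_GKdd_le_GtpYdd_modelχq' p 1 2 even_two)
    let C := (K₀.etaleThetaDataOfClass (etaDdχq p 1 2 even_two)).doubleUnderlineχqOfEtaRes p 1 2 l hl
        (eta_res_etaDdχq p 1 2 even_two l hl)
    let h15 : Literature.AnabelianGeometry.EtaleTheta.ThetaSetting.Prop15iii _ hC :=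
      prop15iii_etaleThetaDataOfClass_etaDdχq p hC SemidirectProduct.inr
        (continuous_inrχq p 1 2) (fun _ => rfl) (map_inr_GK_le_GtpY_modelχq' p 1 2 even_two)
        (map_inr_GKdd_le_GtpYdd_modelχq' p 1 2 even_two)
    let L : C.CuspLabels := ⟨fun _ => ∅, fun _ => ∅, fun _ => rfl⟩
    let hO := ThetaSetting.modelχq_isEtThOrigin p 1 2 even_two
    let hYcl := hYcl_modelχq p 1 2 even_two
    let hp2 := ne_two_of_four_mul_dvd_pred p l.pos hdvd
    let hpl := ne_of_four_mul_dvd_pred p l.pos hdvd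
    let hζ := exists_isPrimitiveRoot_K_modelχq p 1 2 even_two l.pos hdvd
    let hZ : ∀ M : ℕ+, Nonempty (ModelCyclotomes.lDeltaQuot (C.rigidData (τ.modAll M) hC hS h15 L) ≃*
        Literature.IUT.HodgeTheaters.ZHat) := fun M =>
      ModelCyclotomes.nonempty_lDeltaQuot_rigidData_mulEquiv_zHat C (τ.modAll M) hC hS h15 L hO hYcl hlp.ne_zero
    let Sys := EtaleLevels.modelSystem C hC hS hlp hp2 hpl hζ τ.modAll (EtaleThetaDataOfSetting.rootLift C)
      (rootLift_mem_rootCocycles C hC) τ.red_modAll h15 L hZ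
    ∀ (_h218i : ∀ e : Es, (C.rigidData (τ.mod e) hC hS h15 L).Cor218_i)
      (_h219iii : (C.thetaEnvTower τ hC hS).Cor219_iii), Sys.transitionsAreIsos := by
  intro hC hS K₀ C h15 L hO hYcl hp2 hpl hζ hZ Sys h218i h219iii
  exact EtaleLevels.transitionsAreIsos_modelSystem_of_origin C hC hS hlp hp2 hpl hζ τ _ _ h15
    (prop15_i_ii_ofKit_inrSection_modelχq p 1 2 even_two hC).2 L h218i h219iii hO hYcl

/-- **[IUTchII] Prop. 1.5 (i) (printed form), (i)′, (ii)+(iii) for the model family of the Tate curve AT THE TATE MODEL,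
under the residual list {[EtTh] Cor. 2.18 (i) at the chain levels of `τ`, `ThetaEnvTower.Cor219_iii`} ONLY** —
abc-iut-L2-t10's `prop15_i_i'_ii_iii_modelSystem_of_origin` with temp-slimness (`isSlimGroup_piTemp_modelχq`),
`IsOpenMap aug` (`isOpenMap_aug_modelχq`), `IsEtThOrigin`, `hYcl`, Prop. 1.5 (ii)/(iii) of [EtTh] §1, the cusp labelling,
`hζ` and the root cocycle ALL supplied by theorems of the tree (contrast abc-iut-f-150's `…_modelSystem_modelχ`: four
residuals and the binders `E, C, hC, hS, hζ, f, hf`). [claim: Mochizuki2012, status: disputed] (IUTchII §1 Prop 1.5, kurims pp.29-30) -/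
theorem prop15_i_i'_ii_iii_modelSystem_modelTate :
    let hC := compat_modelχq p 1 2 even_two
    let hS := ThetaSetting.modelχq_sec2Hyps p 1 2 even_two
    let K₀ := (kummerCoreχq p 1 2 even_two).toKummerDataOfSection SemidirectProduct.inr (continuous_inrχq p 1 2)
        (fun _ => rfl) (map_inr_GK_le_GtpY_modelχq' p 1 2 even_two) (map_inr_GKdd_le_GtpYdd_modelχq' p 1 2 even_two)
    let C := (K₀.etaleThetaDataOfClass (etaDdχq p 1 2 even_two)).doubleUnderlineχqOfEtaRes p 1 2 l hl
        (eta_res_etaDdχq p 1 2 even_two l hl)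
    let h15 : Literature.AnabelianGeometry.EtaleTheta.ThetaSetting.Prop15iii _ hC :=
      prop15iii_etaleThetaDataOfClass_etaDdχq p hC SemidirectProduct.inr
        (continuous_inrχq p 1 2) (fun _ => rfl) (map_inr_GK_le_GtpY_modelχq' p 1 2 even_two)
        (map_inr_GKdd_le_GtpYdd_modelχq' p 1 2 even_two)
    let L : C.CuspLabels := ⟨fun _ => ∅, fun _ => ∅, fun _ => rfl⟩
    let hO := ThetaSetting.modelχq_isEtThOrigin p 1 2 even_two
    let hYcl := hYcl_modelχq p 1 2 even_two
    let hp2 := ne_two_of_four_mul_dvd_pred p l.pos hdvd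
    let hpl := ne_of_four_mul_dvd_pred p l.pos hdvd
    let hζ := exists_isPrimitiveRoot_K_modelχq p 1 2 even_two l.pos hdvd
    let hZ : ∀ M : ℕ+, Nonempty (ModelCyclotomes.lDeltaQuot (C.rigidData (τ.modAll M) hC hS h15 L) ≃*
        Literature.IUT.HodgeTheaters.ZHat) := fun M =>
      ModelCyclotomes.nonempty_lDeltaQuot_rigidData_mulEquiv_zHat C (τ.modAll M) hC hS h15 L hO hYcl hlp.ne_zero
    let Sys := EtaleLevels.modelSystem C hC hS hlp hp2 hpl hζ τ.modAll (EtaleThetaDataOfSetting.rootLift C)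
      (rootLift_mem_rootCocycles C hC) τ.red_modAll h15 L hZ
    ∀ (_h218i : ∀ e : Es, (C.rigidData (τ.mod e) hC hS h15 L).Cor218_i)
      (_h219iii : (C.thetaEnvTower τ hC hS).Cor219_iii),
      Prop15_ii_iii Sys ∧
        (∀ B : MonoThetaProjSystem (EtaleLevels.modelFamily C hC hS hlp hp2 hpl hζ τ.modAll
            (EtaleThetaDataOfSetting.rootLift C) (rootLift_mem_rootCocycles C hC)),
          B.IsMonoThetaCompatible (EtaleLevels.reductions C hC hS hlp hp2 hpl hζ τ.modAll
            (EtaleThetaDataOfSetting.rootLift C) (rootLift_mem_rootCocycles C hC) τ.red_modAll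
            (isSlimGroup_piTemp_modelχq p 1 2 even_two)) → Prop15_i Sys B) ∧
        ∀ A B : MonoThetaProjSystem (EtaleLevels.modelFamily C hC hS hlp hp2 hpl hζ τ.modAll
            (EtaleThetaDataOfSetting.rootLift C) (rootLift_mem_rootCocycles C hC)),
          Prop15_i' (EtaleLevels.reductions C hC hS hlp hp2 hpl hζ τ.modAll (EtaleThetaDataOfSetting.rootLift C)
            (rootLift_mem_rootCocycles C hC) τ.red_modAll (isSlimGroup_piTemp_modelχq p 1 2 even_two)) A B := by
  intro hC hS K₀ C h15 L hO hYcl hp2 hpl hζ hZ Sys h218i h219iii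
  exact EtaleLevels.prop15_i_i'_ii_iii_modelSystem_of_origin C hC hS hlp hp2 hpl hζ τ _ _
    (isSlimGroup_piTemp_modelχq p 1 2 even_two) (isOpenMap_aug_modelχq p 1 2 even_two) h15
    (prop15_i_ii_ofKit_inrSection_modelχq p 1 2 even_two hC).2 L h218i h219iii hO hYcl

/-! ## §4. Census -/

include hl hdvd in
/-- **SETTING-FREE CENSUS (K-L6, `Sec2Hyps` bundle, Prop. 1.5 rows)**: for every prime `p`, odd prime `l` with
`4l ∣ p − 1` and admissible index chain `Es ∋ 1` (cofinal, totally ordered by divisibility), SOME [EtTh] §1 theta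
setting `D` with `D.IsEtThOrigin ∧ D.Sec2Hyps` carries `E`, `X̲̲`, a compatible cyclotome tower `τ`, Prop. 1.5 (ii) and
(iii) of [EtTh] §1, a cusp labelling, `ζ_{4l} ∈ K`, a ROOT COCYCLE and the cyclotome inputs `hZ` — every binder of the
[IUTchII] Prop. 1.5 natural system — such that its level rows hold outright and its `θ_env` data / Prop. 1.5 (ii) /
(i)(i′)(ii)(iii) summary hold GIVEN ONLY [EtTh] Cor. 2.18 (i) at the chain levels and `ThetaEnvTower.Cor219_iii`
(named, instance form).  Witness: the Tate model and abc-iut-L2-t8's `modelχq_nonempty_cyclotomeTower`.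
[claim: Mochizuki2012, status: disputed] (IUTchII §1 Prop 1.5, kurims pp.29-30) -/
theorem _root_.Literature.IUT.HodgeArakelov.ThetaSetting.exists_isEtThOrigin_sec2Hyps_naturalSystem_of_dvd_pred
    (one_mem : (1 : ℕ+) ∈ Es) (cofinal : ∀ n : ℕ+, ∃ M ∈ Es, n ∣ M)
    (total : ∀ M ∈ Es, ∀ M' ∈ Es, M ∣ M' ∨ M' ∣ M) :
    ∃ (D : Literature.AnabelianGeometry.EtaleTheta.ThetaSetting p) (hO : D.IsEtThOrigin) (hS : D.Sec2Hyps)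
      (hYcl : (D.DtpY.map D.toHat.toMonoidHom).topologicalClosure ≤
        D.DtpY.map D.toHat.toMonoidHom ⊔ (⁅⁅D.DeltaHat, D.DeltaHat⁆, D.DeltaHat⁆).topologicalClosure)
      (E : D.EtaleThetaData) (C : E.DoubleUnderline l) (τ : D.CyclotomeTower l Es)
      (h15 : Literature.AnabelianGeometry.EtaleTheta.ThetaSetting.Prop15iii E hS.compat)
      (_ : Literature.AnabelianGeometry.EtaleTheta.ThetaSetting.Prop15ii E.toKummerData hS.compat) (L : C.CuspLabels)
      (hp2 : p ≠ 2) (hpl : p ≠ (l : ℕ)) (hζ : ∃ ζ : D.K, IsPrimitiveRoot ζ (4 * l))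
      (f : contCocycles D.toTheta D.DeltaTheta C.GtpYdduu) (hf : f ∈ C.rootCocycles hS.compat)
      (hslimX : Literature.AlgebraicGeometry.Frobenioids.IsSlimGroup D.PiTemp),
      (EtaleLevels.naturalSystem C hS.compat hS hlp hp2 hpl hζ τ.modAll f hf τ.red_modAll h15 L (fun M =>
          ModelCyclotomes.nonempty_lDeltaQuot_rigidData_mulEquiv_zHat C (τ.modAll M) hS.compat hS h15 L hO hYcl
            hlp.ne_zero)).PiX = TopGroup.of C.Huu ∧
        MonoThetaProjSystem.IsMonoThetaCompatible
          (EtaleLevels.reductions C hS.compat hS hlp hp2 hpl hζ τ.modAll f hf τ.red_modAll hslimX)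
          (EtaleLevels.naturalSystem C hS.compat hS hlp hp2 hpl hζ τ.modAll f hf τ.red_modAll h15 L (fun M =>
            ModelCyclotomes.nonempty_lDeltaQuot_rigidData_mulEquiv_zHat C (τ.modAll M) hS.compat hS h15 L hO hYcl
              hlp.ne_zero)) ∧
        ((∀ e : Es, (C.rigidData (τ.mod e) hS.compat hS h15 L).Cor218_i) → (C.thetaEnvTower τ hS.compat hS).Cor219_iii →
          Nonempty (ThetaEnvData (EtaleLevels.modelSystem C hS.compat hS hlp hp2 hpl hζ τ.modAll f hf τ.red_modAll
              h15 L (fun M => ModelCyclotomes.nonempty_lDeltaQuot_rigidData_mulEquiv_zHat C (τ.modAll M) hS.compat hS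
                h15 L hO hYcl hlp.ne_zero))) ∧
            (EtaleLevels.modelSystem C hS.compat hS hlp hp2 hpl hζ τ.modAll f hf τ.red_modAll h15 L (fun M =>
              ModelCyclotomes.nonempty_lDeltaQuot_rigidData_mulEquiv_zHat C (τ.modAll M) hS.compat hS h15 L hO hYcl
                hlp.ne_zero)).transitionsAreIsos ∧
            Prop15_ii_iii (EtaleLevels.modelSystem C hS.compat hS hlp hp2 hpl hζ τ.modAll f hf τ.red_modAll h15 L
              (fun M => ModelCyclotomes.nonempty_lDeltaQuot_rigidData_mulEquiv_zHat C (τ.modAll M) hS.compat hS h15 L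
                hO hYcl hlp.ne_zero)) ∧
            ∀ A B : MonoThetaProjSystem (EtaleLevels.modelFamily C hS.compat hS hlp hp2 hpl hζ τ.modAll f hf),
              Prop15_i' (EtaleLevels.reductions C hS.compat hS hlp hp2 hpl hζ τ.modAll f hf τ.red_modAll hslimX) A B) := by
  obtain ⟨τ⟩ := modelχq_nonempty_cyclotomeTower p 1 2 even_two l.pos one_mem cofinal total
  refine ⟨ThetaSetting.modelχq p 1 2 even_two, ThetaSetting.modelχq_isEtThOrigin p 1 2 even_two,
    ThetaSetting.modelχq_sec2Hyps p 1 2 even_two, hYcl_modelχq p 1 2 even_two, _,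
    (((kummerCoreχq p 1 2 even_two).toKummerDataOfSection SemidirectProduct.inr (continuous_inrχq p 1 2)
        (fun _ => rfl) (map_inr_GK_le_GtpY_modelχq' p 1 2 even_two)
        (map_inr_GKdd_le_GtpYdd_modelχq' p 1 2 even_two)).etaleThetaDataOfClass
        (etaDdχq p 1 2 even_two)).doubleUnderlineχqOfEtaRes p 1 2 l hl (eta_res_etaDdχq p 1 2 even_two l hl),
    τ, prop15iii_etaleThetaDataOfClass_etaDdχq p _ SemidirectProduct.inr (continuous_inrχq p 1 2) (fun _ => rfl)
      (map_inr_GK_le_GtpY_modelχq' p 1 2 even_two) (map_inr_GKdd_le_GtpYdd_modelχq' p 1 2 even_two),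
    (prop15_i_ii_ofKit_inrSection_modelχq p 1 2 even_two _).2,
    ⟨fun _ => ∅, fun _ => ∅, fun _ => rfl⟩, ne_two_of_four_mul_dvd_pred p l.pos hdvd,
    ne_of_four_mul_dvd_pred p l.pos hdvd, exists_isPrimitiveRoot_K_modelχq p 1 2 even_two l.pos hdvd, _,
    rootLift_mem_rootCocycles _ _, isSlimGroup_piTemp_modelχq p 1 2 even_two, ?_, ?_, ?_⟩
  · exact (naturalSystem_level_rows_modelTate p l hl hlp hdvd τ).1
  · exact (naturalSystem_level_rows_modelTate p l hl hlp hdvd τ).2.2.2.2.2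
  · intro h218i h219iii
    exact ⟨nonempty_thetaEnvData_modelTate p l hl hlp hdvd τ (h218i ⟨1, τ.one_mem⟩),
      transitionsAreIsos_modelSystem_modelTate p l hl hlp hdvd τ h218i h219iii,
      (prop15_i_i'_ii_iii_modelSystem_modelTate p l hl hlp hdvd τ h218i h219iii).1,
      (prop15_i_i'_ii_iii_modelSystem_modelTate p l hl hlp hdvd τ h218i h219iii).2.2⟩

end ModelTateCarriers

end Literature.IUT.HodgeArakelov

end
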